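import Summits.CriticalPhenomena.PercolationContinuityZ3.Theorems.Transplant.AutChartOrbitsOneLampAutSigns
import Mathlib.Data.Fintype.Pigeonhole
import Mathlib.Order.Interval.Finset.Nat
import Mathlib.Algebra.BigOperators.Group.Finset.Basic
import HarnessLib

/-!
# Label-preserving actions on a one-lamp frame, III: an action with FINITELY MANY ORBITS contains PURE LAMP TRANSLATIONS — by `x^T` for ONE `T ≥ 1`
# and every lamp position `x`, hence by `m^T` for every lamp `m`

builds on p205010 (kernel theorem, internal audit signed; external expert review pending) — nothing in this file uses p205010; pure group theory, no
percolation statement, nothing about any `@[conjecture]`.  Lane `prim-bschramm`, seat `prim-bschramm-p3` gen 36 (DESIGN OWNER; `P3-NILPOTENT.md` §29.3 (b)).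
Helper file (`--supports stmt-CriticalPhenomena-4575 --as helper`).  Def-free.

CONTENT (`F : OneLampFrame Γ`, `A : F.LabelAction 𝒜`, and a finite set `R` of representatives with `𝒜·R = Γ`):
* §1 `exists_translation_on_line` — PIGEONHOLE ON A LAMP LINE: three points `δ s^{k₁}, δ s^{k₂}, δ s^{k₃}` share a representative; the elements of `𝒜`
  carrying the first to the others are isometries of the line (translation or reflection, «…AutDefs» `smul_mul_s_zpow`); one of them, or the quotient of
  two reflections, TRANSLATES the line: `τ·(δ s^k) = δ s^{k+n}`, `n ≥ 1`.  Such a `τ` has trivial tree part, so `τ²` is a pure lamp translation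
  («…AutSigns» `exists_sq_smul_eq_mul`) — by `pos(δ)^{2n}` (`exists_smul_eq_pos_pow_mul`).
* §2 `exists_uniform_translation` — ONE exponent for all positions: the tree parts of `𝒜` reach every element of `H` from the finitely many `tr r`
  (`r ∈ R`), conjugation carries a translation by `x^n` to one by `(conjugate of x)^{n}` (the left rule), so `T := ∏_{r ∈ R} n_r` works for every
  position; products give `m^T` for every `m ∈ L` (`exists_translation_pow_of_mem_L`).
[cite: BenjaminiSchramm1996, Conj. 4; §2 (almost transitive graphs)] [cite: BartholdiErschler2012, §2]
-/

namespace Summit.CriticalPhenomena.PercolationContinuityZ3.Theorems.Transplant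

namespace OneLampFrame

namespace LabelAction

variable {Γ : Type} [Group Γ] {F : OneLampFrame Γ} {𝒜 : Type} [Group 𝒜] [MulAction 𝒜 Γ] (A : F.LabelAction 𝒜)
include A

/-! ### §1 Pigeonhole on a lamp line -/

omit A in
/-- Re-basing a translated line: if `τ` translates the line through `δ₁ = δ s^c` by `n`, it translates the line through `δ` by `n`. [folklore] -/
theorem translation_rebase {τ : 𝒜} {δ δ₁ : Γ} {c n : ℤ} (hδ₁ : δ₁ = δ * F.s ^ c)
    (hτ : ∀ k : ℤ, τ • (δ₁ * F.s ^ k) = δ₁ * F.s ^ (k + n)) (j : ℤ) : τ • (δ * F.s ^ j) = δ * F.s ^ (j + n) := by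
  have e : δ * F.s ^ j = δ₁ * F.s ^ (j - c) := by rw [hδ₁, mul_assoc, ← zpow_add]; congr 2; ring
  rw [e, hτ, hδ₁, mul_assoc, ← zpow_add]; congr 2; ring

/-- **A translation along every lamp line.**  With finitely many orbits, for every vertex `δ` some `τ ∈ 𝒜` translates the lamp line through `δ`:
`τ·(δ s^k) = δ s^{k+n}` for all `k`, with `n ≥ 1`. [folklore] -/
theorem exists_translation_on_line (R : Finset Γ) (hRc : ∀ γ : Γ, ∃ α : 𝒜, ∃ r ∈ R, α • r = γ) (δ : Γ) :
    ∃ (τ : 𝒜) (n : ℤ), 1 ≤ n ∧ ∀ k : ℤ, τ • (δ * F.s ^ k) = δ * F.s ^ (k + n) := by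
  classical
  obtain ⟨α₁, r₁, hr₁, -⟩ := hRc 1
  haveI : Nonempty ↥R := ⟨⟨r₁, hr₁⟩⟩
  choose αf rf hrf hαf using hRc
  -- the representative of `δ s^k`, `k : ℕ`
  let g : ℕ → ↥R := fun k => ⟨rf (δ * F.s ^ (k : ℤ)), hrf _⟩
  obtain ⟨r₀, hinf⟩ := Finite.exists_infinite_fiber g
  have hS : (g ⁻¹' {r₀}).Infinite := Set.infinite_coe_iff.mp hinf
  obtain ⟨k₁, hk₁, -⟩ := hS.exists_gt 0
  obtain ⟨k₂, hk₂, h12⟩ := hS.exists_gt k₁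
  obtain ⟨k₃, hk₃, h23⟩ := hS.exists_gt k₂
  -- `αf (δ s^{kᵢ}) • r₀ = δ s^{kᵢ}`
  have hrep : ∀ {k : ℕ}, k ∈ g ⁻¹' {r₀} → αf (δ * F.s ^ (k : ℤ)) • (r₀ : Γ) = δ * F.s ^ (k : ℤ) := by
    intro k hk
    have hk' : g k = r₀ := hk
    have : (r₀ : Γ) = rf (δ * F.s ^ (k : ℤ)) := by rw [← hk']
    rw [this, hαf]
  set δ₁ : Γ := δ * F.s ^ (k₁ : ℤ) with hδ₁
  -- the two candidates
  set α : 𝒜 := αf (δ * F.s ^ (k₂ : ℤ)) * (αf (δ * F.s ^ (k₁ : ℤ)))⁻¹ with hα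
  set α' : 𝒜 := αf (δ * F.s ^ (k₃ : ℤ)) * (αf (δ * F.s ^ (k₁ : ℤ)))⁻¹ with hα'
  have i1 : (αf (δ * F.s ^ (k₁ : ℤ)))⁻¹ • δ₁ = (r₀ : Γ) := by
    rw [inv_smul_eq_iff, hrep hk₁]
  have hαδ : α • δ₁ = δ₁ * F.s ^ ((k₂ : ℤ) - k₁) := by
    rw [hα, mul_smul, i1, hrep hk₂, hδ₁, mul_assoc, ← zpow_add]
    congr 2; ring
  have hα'δ : α' • δ₁ = δ₁ * F.s ^ ((k₃ : ℤ) - k₁) := by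
    rw [hα', mul_smul, i1, hrep hk₃, hδ₁, mul_assoc, ← zpow_add]
    congr 2; ring
  -- along the line
  have hline : ∀ k : ℤ, α • (δ₁ * F.s ^ k) = δ₁ * F.s ^ (((k₂ : ℤ) - k₁) + A.sgn α δ₁ * k) := fun k => by
    rw [A.smul_mul_s_zpow, hαδ, mul_assoc, ← zpow_add]
  have hline' : ∀ k : ℤ, α' • (δ₁ * F.s ^ k) = δ₁ * F.s ^ (((k₃ : ℤ) - k₁) + A.sgn α' δ₁ * k) := fun k => by
    rw [A.smul_mul_s_zpow, hα'δ, mul_assoc, ← zpow_add]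
  have h12' : (1 : ℤ) ≤ (k₂ : ℤ) - k₁ := by omega
  have h23' : (1 : ℤ) ≤ (k₃ : ℤ) - k₂ := by omega
  rcases A.sgn_eq_or α δ₁ with ha | ha
  · -- `α` translates by `k₂ - k₁`
    refine ⟨α, (k₂ : ℤ) - k₁, h12', translation_rebase hδ₁ fun k => ?_⟩
    rw [hline k, ha, one_mul, add_comm]
  rcases A.sgn_eq_or α' δ₁ with ha' | ha'
  · refine ⟨α', (k₃ : ℤ) - k₁, by omega, translation_rebase hδ₁ fun k => ?_⟩
    rw [hline' k, ha', one_mul, add_comm]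
  -- both reflections: `α' α⁻¹` translates by `k₃ - k₂`
  refine ⟨α' * α⁻¹, (k₃ : ℤ) - k₂, h23', translation_rebase hδ₁ fun k => ?_⟩
  have hinv : α⁻¹ • (δ₁ * F.s ^ k) = δ₁ * F.s ^ (((k₂ : ℤ) - k₁) - k) := by
    rw [inv_smul_eq_iff, hline, ha]; congr 2; ring
  rw [mul_smul, hinv, hline', ha']; congr 2; ring

/-- A line translation has trivial tree part. [folklore] -/
theorem treePart_eq_one_of_translation {τ : 𝒜} {δ : Γ} {n : ℤ} (hτ : ∀ k : ℤ, τ • (δ * F.s ^ k) = δ * F.s ^ (k + n)) :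
    A.treePart τ = 1 := by
  have h0 := hτ 0
  rw [zpow_zero, mul_one, zero_add] at h0
  have e := A.tr_smul τ δ
  rw [h0, F.tr_mul_of_mem_L δ (F.L.zpow_mem F.s_mem n)] at e
  exact (mul_right_cancel (a := A.treePart τ) (b := F.tr δ) (c := 1) (by rw [one_mul]; exact e.symm))

/-- **A pure lamp translation by a power of the position**: for every vertex `δ` some `β ∈ 𝒜` acts on ALL of `Γ` as left multiplication by
`pos(δ)^n`, `n ≥ 1` (the square of a line translation). [folklore] -/
theorem exists_smul_eq_pos_pow_mul (R : Finset Γ) (hRc : ∀ γ : Γ, ∃ α : 𝒜, ∃ r ∈ R, α • r = γ) (δ : Γ) :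
    ∃ (β : 𝒜) (n : ℕ), 1 ≤ n ∧ ∀ γ : Γ, β • γ = F.pos δ ^ n * γ := by
  obtain ⟨τ, n, hn, hτ⟩ := A.exists_translation_on_line R hRc δ
  have hT := A.treePart_eq_one_of_translation hτ
  obtain ⟨m₂, -, hm₂⟩ := A.exists_sq_smul_eq_mul hT
  -- evaluate at `δ`: `m₂ δ = τ²·δ = δ s^{2n} = pos(δ)^{2n} δ`
  have h0 := hτ 0
  rw [zpow_zero, mul_one, zero_add] at h0
  have e : m₂ * δ = F.pos δ ^ (2 * n) * δ := by
    rw [← hm₂ δ, mul_smul, h0, hτ, ← F.mul_s_zpow_eq]; congr 2; ring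
  have hm₂eq : m₂ = F.pos δ ^ (2 * n) := mul_right_cancel e
  refine ⟨τ * τ, (2 * n).toNat, by omega, fun γ => ?_⟩
  rw [hm₂ γ, hm₂eq, ← zpow_natCast, Int.toNat_of_nonneg (by omega)]

/-! ### §2 One exponent for all positions -/

omit A in
/-- Powers of a pure translation are pure translations by the powers. [folklore] -/
theorem pow_smul_eq_pow_mul {β : 𝒜} {m : Γ} (hβ : ∀ γ : Γ, β • γ = m * γ) (j : ℕ) (γ : Γ) : (β ^ j) • γ = m ^ j * γ := by
  induction j generalizing γ with
  | zero => simp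
  | succ j ih => rw [pow_succ, mul_smul, hβ, ih, pow_succ']; group

omit A in
/-- The inverse of a pure translation translates by the inverse. [folklore] -/
theorem inv_smul_eq_inv_mul {β : 𝒜} {m : Γ} (hβ : ∀ γ : Γ, β • γ = m * γ) (γ : Γ) : β⁻¹ • γ = m⁻¹ * γ := by
  rw [inv_smul_eq_iff, hβ, mul_inv_cancel_left]

/-- **Conjugating a pure translation**: if `β` translates by `(h s h⁻¹)^n` (`h ∈ H`) then some element of `𝒜` translates by
`((T h) s (T h)⁻¹)^n`, `T = treePart α` — namely `α β α⁻¹` or its inverse, by the left rule. [folklore] -/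
theorem exists_conj_translation {β : 𝒜} {h : Γ} (hh : h ∈ F.H) {n : ℕ} (hβ : ∀ γ : Γ, β • γ = (h * F.s * h⁻¹) ^ n * γ) (α : 𝒜) :
    ∃ β' : 𝒜, ∀ γ : Γ, β' • γ = (A.treePart α * h * F.s * (A.treePart α * h)⁻¹) ^ n * γ := by
  have hc : ∀ γ : Γ, (α * β * α⁻¹) • γ =
      (A.treePart α * h * F.s * (A.treePart α * h)⁻¹) ^ (A.sgn α h * n) * γ := fun γ => by
    rw [mul_smul, mul_smul, hβ, ← zpow_natCast, A.smul_conj_zpow_mul α hh, smul_inv_smul]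
  rcases A.sgn_eq_or α h with hε | hε
  · refine ⟨α * β * α⁻¹, fun γ => ?_⟩
    rw [hc, hε, one_mul, zpow_natCast]
  · refine ⟨(α * β * α⁻¹)⁻¹, fun γ => ?_⟩
    rw [inv_smul_eq_inv_mul hc, hε, neg_one_mul, zpow_neg, inv_inv, zpow_natCast]

/-- **ONE EXPONENT FOR ALL POSITIONS**: with finitely many orbits there is `T ≥ 1` such that for EVERY `h ∈ H` some element of `𝒜` is the pure lamp
translation by `(h s h⁻¹)^T`. [folklore] -/
theorem exists_uniform_translation (R : Finset Γ) (hRc : ∀ γ : Γ, ∃ α : 𝒜, ∃ r ∈ R, α • r = γ) :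
    ∃ T : ℕ, 1 ≤ T ∧ ∀ h ∈ F.H, ∃ β : 𝒜, ∀ γ : Γ, β • γ = (h * F.s * h⁻¹) ^ T * γ := by
  classical
  -- exponents at the representatives
  have hex : ∀ r : ↥R, ∃ (β : 𝒜) (n : ℕ), 1 ≤ n ∧ ∀ γ : Γ, β • γ = F.pos r ^ n * γ :=
    fun r => A.exists_smul_eq_pos_pow_mul R hRc r
  choose βr nr hnr hβr using hex
  refine ⟨∏ r : ↥R, nr r, ?_, fun h hh => ?_⟩
  · -- a product of numbers `≥ 1` is `≥ 1`
    exact Finset.one_le_prod' fun r _ => hnr r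
  -- `h = α • r`: its position is the conjugate of `pos r` by `treePart α`
  obtain ⟨α, r, hr, hαr⟩ := hRc h
  have hdvd : nr ⟨r, hr⟩ ∣ ∏ r : ↥R, nr r := Finset.dvd_prod_of_mem _ (Finset.mem_univ _)
  obtain ⟨q, hq⟩ := hdvd
  -- `βr^q` translates by `pos r ^ T = (tr r · s · (tr r)⁻¹)^T`
  have hβq : ∀ γ : Γ, (βr ⟨r, hr⟩ ^ q) • γ = (F.tr r * F.s * (F.tr r)⁻¹) ^ (∏ r : ↥R, nr r) * γ := fun γ => by
    rw [pow_smul_eq_pow_mul (hβr ⟨r, hr⟩) q γ, ← pow_mul, ← hq]; rfl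
  obtain ⟨β', hβ'⟩ := A.exists_conj_translation (F.tr_mem r) hβq α
  refine ⟨β', fun γ => ?_⟩
  rw [hβ' γ]
  -- `treePart α · tr r = tr (α • r) = tr h = h`
  have e : A.treePart α * F.tr r = h := by rw [← A.tr_smul, hαr, (F.lam_tr_of_mem_H hh).2]
  rw [e]

omit A in
/-- **Pure translations by `m^T` for every lamp `m`** (products of the position translations; `L` is abelian and generated by the positions).
[folklore] -/
theorem exists_translation_pow_of_mem_L {T : ℕ} (hT : ∀ h ∈ F.H, ∃ β : 𝒜, ∀ γ : Γ, β • γ = (h * F.s * h⁻¹) ^ T * γ)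
    {m : Γ} (hm : m ∈ F.L) : ∃ β : 𝒜, ∀ γ : Γ, β • γ = m ^ T * γ := by
  refine Subgroup.closure_induction (p := fun y _ => ∃ β : 𝒜, ∀ γ : Γ, β • γ = y ^ T * γ) ?_ ?_ ?_ ?_ (F.gen m hm)
  · rintro y ⟨h, hh, rfl⟩; exact hT h hh
  · exact ⟨1, fun γ => by rw [one_smul, one_pow, one_mul]⟩
  · intro x y hx' hy' ⟨βx, hβx⟩ ⟨βy, hβy⟩
    have hc : Commute x y := F.comm x (F.closure_positions_le hx') y (F.closure_positions_le hy')
    exact ⟨βx * βy, fun γ => by rw [mul_smul, hβy, hβx, hc.mul_pow]; group⟩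
  · intro x _ ⟨βx, hβx⟩
    exact ⟨βx⁻¹, fun γ => by rw [inv_smul_eq_inv_mul hβx, inv_pow]⟩

end LabelAction

end OneLampFrame

end Summit.CriticalPhenomena.PercolationContinuityZ3.Theorems.Transplant
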